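import Mathlib.Data.Pi.Interval
import Mathlib.Data.Int.Interval
import Literature.NumberTheory.Automorphic.QuaternionDefiniteNorm
import Literature.NumberTheory.Automorphic.BrandtWeightPos
import Literature.NumberTheory.Automorphic.BrandtEigenLine
import HarnessLib

/-!
# Unit groups of orders in totally definite quaternion algebras over `ℚ` are finite

Topic `NumberTheory/Automorphic`; theorems only. Let `D` be a totally definite quaternion algebra over
`ℚ` (`IsTotallyDefinite ℚ D`, so `D ≃ ℍ[ℚ,a,b]` with `a, b < 0` and `nrd > 0`,
`QuaternionDefiniteNorm.lean`) and `I ⊆ D` a full `ℤ`-lattice (`IsFullLattice`). We prove the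
classical finiteness underlying the Brandt weights `w_c = #O_L(I_c)ˣ / 2` (Voight, GTM 288,
Lemma 17.7.13 and §26.5; Gross 1987 §1: "`R_iˣ` is finite since the norm form is positive definite"):

* `exists_den_of_mem_span` : a `ℤ`-linear functional takes values with a common denominator on a
  finitely generated `ℤ`-submodule;
* `finite_setOf_mem_span_reducedNorm_le` : **a lattice has finitely many points of bounded reduced
  norm** — in the coordinates of `D ≃ ℍ[ℚ,a,b]` the form `nrd = x₀² + |a|x₁² + |b|x₂² + ab x₃²`
  bounds every coordinate, and the coordinates of lattice points have bounded denominators, so the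
  points inject into a finite box of `ℤ⁴`;
* `exists_pos_le_reducedNorm_of_mem_span` : `nrd ≥ 1/M` on the non-zero points of a lattice;
* `finite_units_leftOrder` : **the two-sided units of the left order `O_L(I)` of a full lattice
  `I` form a finite set** (`u v = 1 ⇒ nrd(u) nrd(v) = 1`, `nrd(v) ≥ 1/M'` as `n v ∈ I`, so
  `nrd(n u) ≤ n⁴ M'` and `n u` ranges in a finite set);
* `Brandt.XiSetup.finite_units`, `Brandt.XiSetup.one_le_weight` : for every Brandt setup of type
  `(N⁺, N⁻)` and every class `c`, `O_L(I_c)ˣ` is finite and **`w_c ≥ 1`** — the arithmetic half of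
  the positivity of the weights in `ξ = Σ w_i φ_i²` (`BrandtWeightPos.lean`; Pollack–Weston 2011
  §2.1), now unconditional; `one_le_brandtXi_of_forall_finrank_eq_one` : `ξ ≥ 1` from multiplicity
  one alone (`BrandtEigenLine.lean`).

By-product of the audit of `PollackWeston2011.thm_6_8_ellipticCurve` (triaged XL, not discharged).

## References

* J. Voight, *Quaternion Algebras*, GTM 288 (2021), Lemma 17.7.13, 26.5.1 [Voight2021].
* B. H. Gross, *Heights and the special values of L-series* (1987), §1 [Gross1987].
* M.-F. Vignéras, LNM 800 (1980), Ch. V §1 [VignerasLNM800].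
-/

noncomputable section

open scoped Quaternion

universe u

namespace Literature.NumberTheory.Automorphic

/-! ### Common denominators on finitely generated `ℤ`-submodules -/

section Denominators

variable {M : Type*} [AddCommGroup M]

/-- A `ℤ`-linear functional `f : M → ℚ` has a common denominator on the `ℤ`-span of a finite set:
`d · f(x) ∈ ℤ` for all `x ∈ span t` (`d` = product of the denominators of the `f(g)`, `g ∈ t`).
[folklore] -/
theorem exists_den_of_mem_span (f : M →ₗ[ℤ] ℚ) (t : Finset M) :
    ∃ d : ℕ, d ≠ 0 ∧ ∀ x ∈ Submodule.span ℤ (t : Set M), ∃ z : ℤ, (d : ℚ) * f x = z := by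
  classical
  refine ⟨∏ g ∈ t, (f g).den, Finset.prod_ne_zero_iff.mpr fun g _ => (f g).den_nz, ?_⟩
  intro x hx
  induction hx using Submodule.span_induction with
  | mem g hg =>
    refine ⟨(∏ g' ∈ t.erase g, ((f g').den : ℤ)) * (f g).num, ?_⟩
    rw [← Finset.prod_erase_mul _ _ hg]
    push_cast
    rw [mul_assoc, mul_comm ((f g).den : ℚ) (f g), Rat.mul_den_eq_num]
  | zero => exact ⟨0, by simp⟩
  | add x y _ _ hx hy =>
    obtain ⟨z₁, h₁⟩ := hx
    obtain ⟨z₂, h₂⟩ := hy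
    exact ⟨z₁ + z₂, by rw [map_add, mul_add, h₁, h₂]; push_cast; ring⟩
  | smul n x _ hx =>
    obtain ⟨z, hz⟩ := hx
    exact ⟨n * z, by rw [map_smul, zsmul_eq_mul, mul_left_comm, hz]; push_cast; ring⟩

/-- Simultaneous common denominator for finitely many functionals. [folklore] -/
theorem exists_den_of_mem_span_pi {ι : Type*} [Fintype ι] (f : ι → (M →ₗ[ℤ] ℚ)) (t : Finset M) :
    ∃ d : ℕ, d ≠ 0 ∧ ∀ k, ∀ x ∈ Submodule.span ℤ (t : Set M), ∃ z : ℤ, (d : ℚ) * f k x = z := by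
  classical
  choose d hd hden using fun k => exists_den_of_mem_span (f k) t
  refine ⟨∏ k, d k, Finset.prod_ne_zero_iff.mpr fun k _ => hd k, fun k x hx => ?_⟩
  obtain ⟨z, hz⟩ := hden k x hx
  refine ⟨(∏ j ∈ Finset.univ.erase k, (d j : ℤ)) * z, ?_⟩
  rw [← Finset.prod_erase_mul _ _ (Finset.mem_univ k)]
  push_cast
  rw [mul_assoc, hz]

end Denominators

/-! ### A finite box in `ℤ⁴` -/

/-- Integer vectors with `v_k² ≤ N` for all `k` form a finite set (a sub-box of `[-N, N]^ι`).
[folklore] -/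
theorem finite_setOf_sq_le {ι : Type*} [Fintype ι] [DecidableEq ι] (N : ℤ) :
    {v : ι → ℤ | ∀ k, v k ^ 2 ≤ N}.Finite := by
  refine (Set.finite_Icc (fun _ => -N) (fun _ => N)).subset fun v hv => ?_
  simp only [Set.mem_setOf_eq] at hv
  have habs : ∀ k, |v k| ≤ N := fun k => by
    have h := (Int.natAbs_le_self_sq (v k)).trans (hv k)
    rwa [Int.natCast_natAbs] at h
  exact ⟨fun k => (abs_le.mp (habs k)).1, fun k => (abs_le.mp (habs k)).2⟩

/-! ### Lattice points of bounded reduced norm -/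

/-- `nrd(q · 1) = q²` in `ℍ[ℚ,a,b]`. [folklore] -/
theorem QuaternionAlgebra.reducedNorm_algebraMap (a b q : ℚ) :
    reducedNorm ℚ ℍ[ℚ,a,b] (algebraMap ℚ ℍ[ℚ,a,b] q) = q ^ 2 := by
  rw [reducedNorm_quaternionAlgebra ℚ a b, _root_.QuaternionAlgebra.algebraMap_eq]
  ring

section Lattice

variable {D : Type u} [Ring D] [Algebra ℚ D] [IsQuaternionAlgebra ℚ D]

/-- `nrd(q · 1) = q²` in any quaternion algebra over `ℚ`. [folklore] -/
theorem reducedNorm_algebraMap_rat (q : ℚ) : reducedNorm ℚ D (algebraMap ℚ D q) = q ^ 2 := by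
  obtain ⟨a, b, -, -, ⟨e⟩⟩ := IsQuaternionAlgebra.exists_algEquiv_quaternionAlgebra ℚ D
  rw [← reducedNorm_algEquiv e, AlgEquiv.commutes, QuaternionAlgebra.reducedNorm_algebraMap]

/-- `nrd(n • x) = n² nrd(x)` for an integer `n`. [folklore] -/
theorem reducedNorm_zsmul (n : ℤ) (x : D) :
    reducedNorm ℚ D (n • x) = (n : ℚ) ^ 2 * reducedNorm ℚ D x := by
  have : (n • x : D) = algebraMap ℚ D n * x := by
    rw [Algebra.algebraMap_eq_smul_one, smul_mul_assoc, one_mul, Int.cast_smul_eq_zsmul]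
  rw [this, reducedNorm_mul_holds ℚ D, reducedNorm_algebraMap_rat]

/-- **Coordinates and norm of a totally definite `D` over `ℚ`.** There are an isomorphism of
`ℚ`-vector spaces `T : D ≃ ℚ⁴` and weights `w_k > 0` with `nrd(x) = Σ_k w_k (T x)_k²` (the
coordinates of `D ≃ ℍ[ℚ,a,b]`, `a, b < 0`, with `w = (1, -a, -b, ab)`). [cite: VignerasLNM800, Ch. I §1 p. 3] -/
theorem exists_coords_reducedNorm_eq_sum (hdef : IsTotallyDefinite ℚ D) :
    ∃ (T : D ≃ₗ[ℚ] (Fin 4 → ℚ)) (w : Fin 4 → ℚ), (∀ k, 0 < w k) ∧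
      ∀ x : D, reducedNorm ℚ D x = ∑ k, w k * (T x k) ^ 2 := by
  obtain ⟨a, b, ha, hb, ⟨e⟩⟩ := exists_algEquiv_quaternionAlgebra_of_isTotallyDefinite D hdef
  refine ⟨e.toLinearEquiv.trans (QuaternionAlgebra.linearEquivTuple a 0 b), ![1, -a, -b, a * b],
    ?_, fun x => ?_⟩
  · intro k
    fin_cases k
    · exact one_pos
    · simpa using ha
    · simpa using hb
    · exact mul_pos_of_neg_of_neg ha hb
  · rw [← reducedNorm_algEquiv e x, QuaternionAlgebra.reducedNorm_eq_sum_sq]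
    simp [Fin.sum_univ_four, QuaternionAlgebra.equivTuple_apply]

/-- **A lattice has finitely many points of bounded reduced norm** (totally definite `D` over `ℚ`):
for a finite set `t ⊆ D` and a bound `B`, `{x ∈ ℤ t : nrd(x) ≤ B}` is finite. [cite: Voight2021, Lemma 17.7.13] -/
theorem finite_setOf_mem_span_reducedNorm_le (hdef : IsTotallyDefinite ℚ D) (t : Finset D)
    (B : ℚ) : {x : D | x ∈ Submodule.span ℤ (t : Set D) ∧ reducedNorm ℚ D x ≤ B}.Finite := by
  classical
  obtain ⟨T, w, hw, hn⟩ := exists_coords_reducedNorm_eq_sum hdef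
  -- the coordinate functionals are `ℤ`-linear; common denominator `d`
  let f : Fin 4 → (D →ₗ[ℤ] ℚ) := fun k =>
    (LinearMap.proj k).comp (T.toLinearMap.restrictScalars ℤ)
  have hf : ∀ k x, f k x = T x k := fun k x => rfl
  obtain ⟨d, hd, hden⟩ := exists_den_of_mem_span_pi f t
  -- a natural number bounding `d² B / w_k` for every `k`
  obtain ⟨N, hN⟩ := exists_nat_ge (∑ k, (d : ℚ) ^ 2 * max B 0 / w k)
  have hNk : ∀ k, (d : ℚ) ^ 2 * max B 0 / w k ≤ N := fun k =>
    le_trans (Finset.single_le_sum (f := fun k => (d : ℚ) ^ 2 * max B 0 / w k)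
      (fun j _ => div_nonneg (mul_nonneg (sq_nonneg _) (le_max_right _ _)) (hw j).le)
      (Finset.mem_univ k)) hN
  -- the scaled coordinate map is injective
  let G : D → (Fin 4 → ℚ) := fun x k => (d : ℚ) * T x k
  have hG : Function.Injective G := by
    intro x y hxy
    apply T.injective
    funext k
    have := congrFun hxy k
    exact mul_left_cancel₀ (by exact_mod_cast hd : (d : ℚ) ≠ 0) this
  refine Set.Finite.of_finite_image ?_ hG.injOn
  refine ((finite_setOf_sq_le (ι := Fin 4) (N : ℤ)).image fun v k => ((v k : ℤ) : ℚ)).subset ?_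
  rintro _ ⟨x, ⟨hx, hxB⟩, rfl⟩
  -- integrality of the scaled coordinates
  choose z hz using fun k => hden k x hx
  refine ⟨z, fun k => ?_, funext fun k => ?_⟩
  · -- `z_k² = d² (T x)_k² ≤ d² nrd(x) / w_k ≤ d² B / w_k ≤ N`
    have hzk : (z k : ℚ) = (d : ℚ) * T x k := by rw [← hz k, hf]
    have hterm : w k * (T x k) ^ 2 ≤ reducedNorm ℚ D x := by
      rw [hn x]
      exact Finset.single_le_sum (f := fun j => w j * (T x j) ^ 2)
        (fun j _ => mul_nonneg (hw j).le (sq_nonneg _)) (Finset.mem_univ k)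
    have h1 : (T x k) ^ 2 ≤ max B 0 / w k := by
      rw [le_div_iff₀ (hw k), mul_comm]
      exact hterm.trans (hxB.trans (le_max_left _ _))
    have h2 : ((z k : ℚ)) ^ 2 ≤ N := by
      rw [hzk, mul_pow]
      calc (d : ℚ) ^ 2 * (T x k) ^ 2 ≤ (d : ℚ) ^ 2 * (max B 0 / w k) :=
            mul_le_mul_of_nonneg_left h1 (sq_nonneg _)
        _ = (d : ℚ) ^ 2 * max B 0 / w k := by ring
        _ ≤ N := hNk k
    exact_mod_cast h2
  · simp only [G]
    rw [← hz k, hf]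

/-- **`nrd ≥ 1/M` on the non-zero points of a lattice**: the values of the reduced norm on the
`ℤ`-span of a finite set have a common denominator `M`, so a non-zero point has `nrd ≥ 1/M`
(`nrd > 0` by definiteness). [folklore] -/
theorem exists_pos_le_reducedNorm_of_mem_span (hdef : IsTotallyDefinite ℚ D) (t : Finset D) :
    ∃ δ : ℚ, 0 < δ ∧ ∀ x ∈ Submodule.span ℤ (t : Set D), x ≠ 0 → δ ≤ reducedNorm ℚ D x := by
  classical
  obtain ⟨T, w, hw, hn⟩ := exists_coords_reducedNorm_eq_sum hdef
  let f : Fin 4 → (D →ₗ[ℤ] ℚ) := fun k =>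
    (LinearMap.proj k).comp (T.toLinearMap.restrictScalars ℤ)
  have hf : ∀ k x, f k x = T x k := fun k x => rfl
  obtain ⟨d, hd, hden⟩ := exists_den_of_mem_span_pi f t
  -- common denominator of the weights
  let W : ℕ := ∏ k, (w k).den
  have hW : W ≠ 0 := Finset.prod_ne_zero_iff.mpr fun k _ => (w k).den_nz
  have hWk : ∀ k, ∃ m : ℤ, (W : ℚ) * w k = m := fun k => by
    refine ⟨(∏ j ∈ Finset.univ.erase k, ((w j).den : ℤ)) * (w k).num, ?_⟩
    simp only [W]
    rw [← Finset.prod_erase_mul _ _ (Finset.mem_univ k)]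
    push_cast
    rw [mul_assoc, mul_comm ((w k).den : ℚ) (w k), Rat.mul_den_eq_num]
  refine ⟨1 / ((d : ℚ) ^ 2 * W), by positivity, fun x hx hx0 => ?_⟩
  -- `d² W nrd(x)` is a positive integer
  choose z hz using fun k => hden k x hx
  choose m hm using hWk
  have hint : (d : ℚ) ^ 2 * W * reducedNorm ℚ D x = ((∑ k, m k * z k ^ 2 : ℤ) : ℚ) := by
    rw [hn x, Finset.mul_sum]
    push_cast
    refine Finset.sum_congr rfl fun k _ => ?_
    have hzk : (z k : ℚ) = (d : ℚ) * T x k := by rw [← hz k, hf]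
    rw [hzk, ← hm k]
    ring
  have hpos : 0 < reducedNorm ℚ D x := reducedNorm_pos_of_isTotallyDefinite D hdef hx0
  have hposZ : (0 : ℚ) < ((∑ k, m k * z k ^ 2 : ℤ) : ℚ) := by
    rw [← hint]; positivity
  have hone : (1 : ℚ) ≤ ((∑ k, m k * z k ^ 2 : ℤ) : ℚ) := by
    have : (0 : ℤ) < ∑ k, m k * z k ^ 2 := by exact_mod_cast hposZ
    exact_mod_cast this
  rw [div_le_iff₀ (by positivity)]
  calc (1 : ℚ) ≤ ((∑ k, m k * z k ^ 2 : ℤ) : ℚ) := hone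
    _ = reducedNorm ℚ D x * ((d : ℚ) ^ 2 * W) := by rw [← hint]; ring

/-! ### Units of the left order of a full lattice -/

/-- **The unit group of the left order of a full lattice is finite** (totally definite `D` over
`ℚ`): `{u ∈ O_L(I) : ∃ v ∈ O_L(I), uv = vu = 1}` is a finite set (Voight Lemma 17.7.13 / 26.5.1;
Gross 1987 §1; Vignéras V §1). Proof: with `n ≠ 0`, `n · 1 ∈ I`, one has `n O_L(I) ⊆ I`; from
`nrd(u) nrd(v) = 1` and `nrd(n v) ≥ δ` get `nrd(n u) ≤ n⁴/δ`, and `n u` ranges in the finite set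
of lattice points of `I` of bounded norm. [cite: Voight2021, Lemma 17.7.13] -/
theorem finite_units_leftOrder (hdef : IsTotallyDefinite ℚ D) {I : Submodule ℤ D}
    (hI : IsFullLattice D I) :
    {x : D | x ∈ Brandt.leftOrder I ∧
      ∃ y ∈ Brandt.leftOrder I, x * y = 1 ∧ y * x = 1}.Finite := by
  classical
  haveI : Nontrivial D := Module.nontrivial_of_finrank_pos (R := ℚ)
    (by rw [IsQuaternionAlgebra.finrank_eq_four (K := ℚ) (D := D)]; norm_num)
  obtain ⟨t, ht⟩ := hI.1
  obtain ⟨n, hn, hn1⟩ := hI.2 1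
  -- `n • O_L(I) ⊆ I`
  have hnO : ∀ x ∈ Brandt.leftOrder I, n • x ∈ Submodule.span ℤ (t : Set D) := by
    intro x hx
    rw [ht]
    have := hx _ hn1
    rwa [mul_smul_comm, mul_one] at this
  obtain ⟨δ, hδ, hδle⟩ := exists_pos_le_reducedNorm_of_mem_span hdef t
  have hfin := finite_setOf_mem_span_reducedNorm_le hdef t ((n : ℚ) ^ 2 * ((n : ℚ) ^ 2 / δ))
  -- inject `u ↦ n • u` (`D` is a `ℚ`-vector space, so `n • ·` is injective for `n ≠ 0`)
  have hnQ : (n : ℚ) ≠ 0 := by exact_mod_cast hn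
  have hzq : ∀ x : D, n • x = (n : ℚ) • x := fun x => (Int.cast_smul_eq_zsmul ℚ n x).symm
  have hinj : Set.InjOn (fun x : D => n • x) Set.univ := fun x _ y _ hxy => by
    have hxy' : (n : ℚ) • x = (n : ℚ) • y := by simpa only [hzq] using hxy
    exact smul_right_injective D hnQ hxy'
  refine Set.Finite.of_finite_image (hfin.subset ?_) (hinj.mono (Set.subset_univ _))
  rintro _ ⟨u, ⟨hu, v, hv, huv, -⟩, rfl⟩
  refine ⟨hnO u hu, ?_⟩
  -- norms: `nrd u * nrd v = 1`, `δ ≤ nrd (n • v) = n² nrd v`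
  have h1 : reducedNorm ℚ D 1 = 1 := by
    rw [← map_one (algebraMap ℚ D), reducedNorm_algebraMap_rat, one_pow]
  have hmul : reducedNorm ℚ D u * reducedNorm ℚ D v = 1 := by
    rw [← reducedNorm_mul_holds ℚ D, huv, h1]
  have hv0 : v ≠ 0 := by
    rintro rfl
    rw [mul_zero] at huv
    exact zero_ne_one huv
  have hnv0 : n • v ≠ 0 := by
    rw [hzq]
    exact smul_ne_zero hnQ hv0
  have hδv : δ ≤ (n : ℚ) ^ 2 * reducedNorm ℚ D v := by
    rw [← reducedNorm_zsmul]
    exact hδle _ (hnO v hv) hnv0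
  have hvpos : 0 < reducedNorm ℚ D v := reducedNorm_pos_of_isTotallyDefinite D hdef hv0
  have hn2 : (0 : ℚ) < (n : ℚ) ^ 2 := by positivity
  -- `nrd u = 1 / nrd v ≤ n² / δ`
  have hu_le : reducedNorm ℚ D u ≤ (n : ℚ) ^ 2 / δ := by
    have hu_eq : reducedNorm ℚ D u = 1 / reducedNorm ℚ D v := by
      field_simp
      linarith [hmul]
    rw [hu_eq, div_le_div_iff₀ hvpos hδ, one_mul]
    linarith [hδv]
  rw [reducedNorm_zsmul]
  exact mul_le_mul_of_nonneg_left hu_le hn2.le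

end Lattice

/-! ### The Brandt weights of a setup are positive -/

namespace Brandt

variable {Nplus Nminus : ℕ}

/-- **The unit group `O_L(I_c)ˣ` of every class of a Brandt setup is finite** (the algebra of a
setup is totally definite over `ℚ` and `I_c` is a full lattice). [cite: Voight2021, Lemma 17.7.13] -/
theorem XiSetup.finite_units (S : XiSetup Nplus Nminus) (c : ClassSet S.O) :
    {x : S.D | x ∈ leftOrder c.rep ∧ ∃ y ∈ leftOrder c.rep, x * y = 1 ∧ y * x = 1}.Finite :=
  finite_units_leftOrder S.isTotallyDefinite c.rep_mem.1

/-- **The Brandt weights of a setup are positive: `w_c ≥ 1`** for every setup `S` of type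
`(N⁺, N⁻)` and every class `c` — unconditionally (`XiSetup.weight_pos` of `BrandtWeightPos.lean`
with the finiteness just proved). Hence `ξ = Σ_c w_c φ_c² ≥ 1` on any eigen-line
(`BrandtEigenLine.lean`). [cite: Voight2021, 41.1.3] -/
theorem XiSetup.one_le_weight (S : XiSetup Nplus Nminus) (c : ClassSet S.O) : 1 ≤ weight S.O c :=
  S.weight_pos c (S.finite_units c)

end Brandt

/-- **`ξ ≥ 1` from multiplicity one alone.** If some Brandt setup of type `(N⁺, N⁻)` exists and in
every setup the rational eigenspace of the Brandt matrices for `λ` (primes `p ∤ N⁺N⁻`) is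
one-dimensional, then `1 ≤ brandtXi N⁺ N⁻ λ` — `one_le_brandtXi_of_forall` of `BrandtEigenLine.lean`
with the weight hypothesis now discharged by `Brandt.XiSetup.one_le_weight`. [folklore] -/
theorem one_le_brandtXi_of_forall_finrank_eq_one {Nplus Nminus : ℕ} {lam : ℕ → ℤ}
    (hne : Nonempty (Brandt.XiSetup Nplus Nminus))
    (h : ∀ (S : Brandt.XiSetup Nplus Nminus) [Fintype (Brandt.ClassSet S.O)],
      Module.finrank ℚ (Brandt.eigenSpace ℚ (Nplus * Nminus) (Brandt.matrix S.O) lam) = 1) :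
    1 ≤ brandtXi Nplus Nminus lam :=
  one_le_brandtXi_of_forall hne fun S _ => ⟨fun c => S.one_le_weight c, h S⟩

end Literature.NumberTheory.Automorphic

end
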